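import Mathlib
import HarnessLib
import Literature.Computability.AlgebraicComplexity.GroupTheoreticMatMul
import Literature.Computability.AlgebraicComplexity.GroupTheoreticMatMulProofs

/-!
# Crux `AutomaticPackingThesis` (stmt-MatrixMultiplication-7356), line `Sketch` — pricing of the open stub

The line's one open stub `stub_cyclicBeat` asks, for every `τ > 2/3`, for a finite STPP design
`(Aᵢ, Bᵢ, Cᵢ)_{i<n}` in some cyclic group `ℤ/p^K` with `p^K < Σᵢ (|Aᵢ||Bᵢ||Cᵢ|)^τ`. This file
prices every single witness of that stub in terms of the exponent of matrix multiplication, by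
the fundamental inequality of the group-theoretic approach (Cohn–Kleinberg–Szegedy–Umans 2005,
Thm. 5.5, abelian case; tree theorem `CohnKleinbergSzegedyUmans2005_5_5_abelian_holds`):
a design beating its host at exponent `τ` forces `ω(ℂ) < 3τ` (`stub_beatPricesOmega`), and more
generally this holds in every finite abelian host (`omega_lt_three_mul_of_isSTPP_beat`).
Consequently the open window `2/3 < τ < 4/5` of the stub is graded: a witness at `τ` is an
unconditional proof of `ω(ℂ) < 3τ` (`τ = 0.79` would give `ω < 2.37`).
-/

-- single-conjunct summit: the mandated namespace repeats `MatrixMultiplication`.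
set_option linter.dupNamespace false

namespace Summit.MatrixMultiplication.MatrixMultiplication.Theorems.AutomaticPackingThesis

open Literature.Computability.AlgebraicComplexity

/-- **Per-exponent pricing of STPP designs in a finite abelian group** (CKSU 2005 Thm. 5.5 read at
one exponent): if an STPP family `(Aᵢ, Bᵢ, Cᵢ)_{i<n}` in a finite abelian group `H` satisfies
`|H| < Σᵢ (|Aᵢ||Bᵢ||Cᵢ|)^τ` for some `τ > 0`, then `ω(ℂ) < 3τ` (`τ > 0` is needed only to
discard empty blocks, `0^τ = 0`; for `τ = 0` empty blocks would count `1` each). Indeed if `3τ ≤ ω` then `τ ≤ ω/3`, every block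
product is `0` or `≥ 1`, so `Σᵢ xᵢ^τ ≤ Σᵢ xᵢ^{ω/3} ≤ |H|` by Thm. 5.5, contradicting the
hypothesis. [cite: CohnKleinbergSzegedyUmans2005, Thm. 5.5] -/
theorem omega_lt_three_mul_of_isSTPP_beat (H : Type) [AddCommGroup H] [Fintype H] (τ : ℝ)
    (hτ : 0 < τ) (n : ℕ) (A B C : Fin n → Finset H) (hS : IsSTPP A B C)
    (hbeat : (Fintype.card H : ℝ) < ∑ i, (((A i).card * (B i).card * (C i).card : ℕ) : ℝ) ^ τ) :
    omega ℂ < 3 * τ := by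
  by_contra hle
  rw [not_lt] at hle
  have hcksu := CohnKleinbergSzegedyUmans2005_5_5_abelian_holds H n A B C hS
  have hmono : ∑ i, (((A i).card * (B i).card * (C i).card : ℕ) : ℝ) ^ τ ≤
      ∑ i, (((A i).card * (B i).card * (C i).card : ℕ) : ℝ) ^ (omega ℂ / 3) := by
    refine Finset.sum_le_sum fun i _ => ?_
    rcases Nat.eq_zero_or_pos ((A i).card * (B i).card * (C i).card) with h0 | hpos
    · rw [h0, Nat.cast_zero, Real.zero_rpow hτ.ne']
      exact Real.rpow_nonneg le_rfl _
    · exact Real.rpow_le_rpow_of_exponent_le (by exact_mod_cast hpos) (by linarith)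
  linarith

/-- **Pricing of the open stub `stub_cyclicBeat` of line `Sketch`** (registered stub
`stub_beatPricesOmega`): a finite STPP design in a cyclic group `ℤ/p^K` (`p ≥ 2`) that beats
its host at exponent `τ > 0`, `p^K < Σᵢ (|Aᵢ||Bᵢ||Cᵢ|)^τ`, proves `ω(ℂ) < 3τ`. So every witness of
the stub in its open window `2/3 < τ < 4/5` is an unconditional improvement of the exponent of
matrix multiplication to below `3τ < 2.4`, and witnesses for all `τ > 2/3` give `ω(ℂ) = 2`
(the route assembly). [cite: CohnKleinbergSzegedyUmans2005, Thm. 5.5] -/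
theorem stub_beatPricesOmega (τ : ℝ) (hτ : 0 < τ) (p K n : ℕ) (hp : 2 ≤ p)
    (A B C : Fin n → Finset (ZMod (p ^ K))) (hS : IsSTPP A B C)
    (hbeat : (p : ℝ) ^ K < ∑ i, (((A i).card * (B i).card * (C i).card : ℕ) : ℝ) ^ τ) :
    omega ℂ < 3 * τ := by
  haveI : NeZero (p ^ K) := ⟨pow_ne_zero _ (by omega)⟩
  refine omega_lt_three_mul_of_isSTPP_beat (ZMod (p ^ K)) τ hτ n A B C hS ?_
  rw [ZMod.card, Nat.cast_pow]
  exact hbeat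

end Summit.MatrixMultiplication.MatrixMultiplication.Theorems.AutomaticPackingThesis
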